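import Summits.AtomisticToContinuum.HydrodynamicLimit.Theorems.EquilibriumFastWindowLD.Negative.ConservedWindowSums
import Summits.AtomisticToContinuum.HydrodynamicLimit.Theorems.CorrectorPressureDecay.Negative.OrthEnergyTools

/-!
# `EquilibriumFastWindowLD` — negative knowledge (b.2): the β-CEILING is a hard wall, and it depends on `F`

Support file for crux `stmt-AtomisticToContinuum-14440` (`TwoClocks.EquilibriumFastWindowLD`), written by the
standing disprover (cdisprove seat). Def-free. For every amplitude `A > 0` the observable
`F_A(x,v) = A(‖v‖² − 15 + 12√2·e^{−v₀²/2})` IS ADMISSIBLE for the crux at `θ₀ = 1`, `u₀ = 0` — continuous, of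
quadratic growth (`C = (15+12√2)A`), and `M_{1,0,1}`-orthogonal to `1` (`3 − 15 + 12√2·2^{-1/2} = 0`), to every `v_j`
(even in each coordinate) and to `|v|²` (`15 − 45 + 12√2·(2^{-3/2} + 2·2^{-1/2}) = 0`; Wick `E‖v‖⁴ = 15` and the cooled
Gaussian integrals of `CorrectorPressureDecay/Negative/OrthEnergyTools.lean`) — and yet, because
`F_A ≥ A(‖v‖² − 15)` and the window sum of `‖v‖²` is CONSERVED (`windowSum_affine_normSq_eq`), its window
exponential moment is `+∞` as soon as `βA ≥ ½`, at EVERY `σ ≤ 1/2`, EVERY flow, EVERY window and EVERY `N`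
(`windowMoment_FA_eq_top`: product formula + `∫ e^{x²/2·(2βA)} dγ₁ = ∞`). Consequences:

* `two_mul_beta_mul_lt_one_of_windowMoment_ne_top` — any finite window moment of `F_A` at a tilt `β > 0` forces
  `β < 1/(2A)`: in the crux's conclusion for `F_A` necessarily `β₀ < 1/(2A) = (15+12√2)/(2 C_{F_A})`. The "small tilt"
  quantifier `∃ β₀` AFTER `∀ F` is load-bearing and `β₀` must scale like `1/C_F` (the docstring's finiteness range
  `|β| < 1/(4Cθ₀)` is sharp up to the constant); the strengthening with `β₀` uniform in `F` is false
  (`Negative/UniformBeta.lean`).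
* Reading for provers / the dock: every transfer of the crux must carry the tilt range `β₀(F) ≍ 1/(C_Fθ₀)` of the
  SPECIFIC currents it consumes; Hölder splits that move tilt onto a quadratic-growth piece must scale the conjugate
  exponent with `β` (as card `bounded-frozen-normal-form` R1 does).

All `[folklore]`.
-/

noncomputable section

open MeasureTheory ProbabilityTheory Real Set
open scoped ENNReal

namespace Summit.AtomisticToContinuum.HydrodynamicLimit.Theorems.EquilibriumFastWindowLDNegative

open Literature.Analysis.FluidPDE Literature.MathematicalPhysics.KineticTheory
open Summit.AtomisticToContinuum.HydrodynamicLimit.Theorems.CorrectorPressureDecayNegative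
open Summit.AtomisticToContinuum.HydrodynamicLimit.Theorems.CorrectorPressureDecayNegative.OrthEnergy
  (integral_prod_coord_stdGaussian integral_exp_neg_mul_sq_gaussianReal integral_mul_exp_neg_mul_sq_gaussianReal
    integral_sq_gaussianReal)
open Summit.AtomisticToContinuum.HydrodynamicLimit.Theorems.CorrectorPressureDecayNegative.OrthMomentum
  (integral_coord_stdGaussian)

/-! ## Divergent quadratic exponential moments -/

/-- **`∫ e^{a x²} dN(0,1) = ∞` for `2a ≥ 1`** (the density `(2π)^{-1/2} e^{(a − ½)x²}` is bounded below by a positive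
constant on `ℝ`). [folklore] -/
theorem lintegral_exp_mul_sq_gaussianReal_eq_top {a : ℝ} (ha : 1 ≤ 2 * a) :
    ∫⁻ x, ENNReal.ofReal (Real.exp (a * x ^ 2)) ∂(gaussianReal 0 1) = ∞ := by
  rw [gaussianReal_of_var_ne_zero 0 one_ne_zero,
    lintegral_withDensity_eq_lintegral_mul₀ (measurable_gaussianPDF 0 1).aemeasurable
      (by fun_prop : Measurable fun x : ℝ => ENNReal.ofReal (Real.exp (a * x ^ 2))).aemeasurable]
  set c : ℝ≥0∞ := ENNReal.ofReal ((Real.sqrt (2 * π))⁻¹) with hc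
  have hc0 : c ≠ 0 := by
    rw [hc]
    exact (ENNReal.ofReal_pos.2 (by positivity)).ne'
  have hle : ∀ x : ℝ, c ≤ (gaussianPDF 0 1 * fun x => ENNReal.ofReal (Real.exp (a * x ^ 2))) x := by
    intro x
    simp only [Pi.mul_apply, gaussianPDF, gaussianPDFReal_def, NNReal.coe_one, mul_one, sub_zero]
    rw [← ENNReal.ofReal_mul (by positivity), hc, mul_assoc, ← Real.exp_add]
    refine ENNReal.ofReal_le_ofReal ?_
    have hexp : 1 ≤ Real.exp (-x ^ 2 / 2 + a * x ^ 2) := Real.one_le_exp (by nlinarith [sq_nonneg x])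
    have hs : 0 ≤ (Real.sqrt (2 * π))⁻¹ := by positivity
    nlinarith
  refine eq_top_iff.2 ?_
  calc (⊤ : ℝ≥0∞) = c * volume (Set.univ : Set ℝ) := by rw [Real.volume_univ, ENNReal.mul_top hc0]
    _ = ∫⁻ _ : ℝ, c := by rw [lintegral_const]
    _ ≤ _ := lintegral_mono hle

/-- **`∫ e^{s‖w‖²} dγ₃(w) = ∞` for `2s ≥ 1`** (bound below by the first coordinate). [folklore] -/
theorem lintegral_exp_mul_normSq_stdGaussian_eq_top {s : ℝ} (hs : 1 ≤ 2 * s) :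
    ∫⁻ w, ENNReal.ofReal (Real.exp (s * ‖w‖ ^ 2)) ∂(stdGaussian V3) = ∞ := by
  have hs0 : 0 ≤ s := by linarith
  have hle : ∀ w : V3, ENNReal.ofReal (Real.exp (s * (w 0) ^ 2)) ≤ ENNReal.ofReal (Real.exp (s * ‖w‖ ^ 2)) := by
    intro w
    refine ENNReal.ofReal_le_ofReal (Real.exp_le_exp.2 (mul_le_mul_of_nonneg_left ?_ hs0))
    have h1 : |w 0| ≤ ‖w‖ := by simpa [Real.norm_eq_abs] using PiLp.norm_apply_le w 0
    calc (w 0) ^ 2 = |w 0| ^ 2 := (sq_abs _).symm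
      _ ≤ ‖w‖ ^ 2 := pow_le_pow_left₀ (abs_nonneg _) h1 2
  refine eq_top_iff.2 ?_
  have hf : Measurable fun x : ℝ => ENNReal.ofReal (Real.exp (s * x ^ 2)) := by fun_prop
  calc (⊤ : ℝ≥0∞) = ∫⁻ x, ENNReal.ofReal (Real.exp (s * x ^ 2)) ∂(gaussianReal 0 1) :=
        (lintegral_exp_mul_sq_gaussianReal_eq_top hs).symm
    _ = ∫⁻ w, ENNReal.ofReal (Real.exp (s * (w 0) ^ 2)) ∂(stdGaussian V3) :=
        ((BoltzmannGreenKuboOrthMomentum.measurePreserving_coord 0).lintegral_comp hf).symm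
    _ ≤ _ := lintegral_mono hle

/-! ## The admissible witness `F_A = A(‖v‖² − 15 + 12√2 e^{−v₀²/2})`: Gaussian bookkeeping -/

/-- `∫ e^{−x²/2} dN(0,1) = (√2)⁻¹`. [folklore] -/
theorem integral_exp_neg_half_sq_gaussianReal :
    ∫ x, Real.exp (-(1 / 2) * x ^ 2) ∂(gaussianReal 0 1) = (Real.sqrt 2)⁻¹ := by
  have h := integral_exp_neg_mul_sq_gaussianReal (c := 1) (by norm_num)
  norm_num at h
  simpa using h

/-- `∫ x² e^{−x²/2} dN(0,1) = (√2)⁻¹³` (scaling identity of the cooled Gaussian). [folklore] -/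
theorem integral_sq_mul_exp_neg_half_sq_gaussianReal :
    ∫ x, x ^ 2 * Real.exp (-(1 / 2) * x ^ 2) ∂(gaussianReal 0 1) = (Real.sqrt 2)⁻¹ ^ 3 := by
  have h := integral_mul_exp_neg_mul_sq_gaussianReal (fun x => x ^ 2) (c := 1) (by norm_num)
  rw [show (1 : ℝ) + 1 = 2 by norm_num] at h
  rw [h]
  have h2 : ∫ y, ((Real.sqrt 2)⁻¹ * y) ^ 2 ∂(gaussianReal 0 1) = (Real.sqrt 2)⁻¹ ^ 2 := by
    simp_rw [mul_pow]
    rw [integral_const_mul, integral_sq_gaussianReal, mul_one]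
  rw [h2]
  ring

/-- Independence of the coordinates `0` and `k ≠ 0` under `γ₃`, for the two factors used below:
`∫ g(w₀) h(wₖ) dγ₃ = (∫ g dγ₁)(∫ h dγ₁)`. [folklore] -/
theorem integral_coord_zero_mul_coord_stdGaussian {g h : ℝ → ℝ} (hg : Measurable g) (hh : Measurable h)
    {k : Fin 3} (hk : k ≠ 0) :
    ∫ w, g (w 0) * h (w k) ∂(stdGaussian V3) = (∫ x, g x ∂(gaussianReal 0 1)) * ∫ x, h x ∂(gaussianReal 0 1) := by
  classical
  set f : Fin 3 → ℝ → ℝ := fun l => if l = 0 then g else if l = k then h else fun _ => 1 with hf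
  have hfm : ∀ l, Measurable (f l) := by
    intro l
    by_cases hl0 : l = 0
    · simp only [hf, if_pos hl0]; exact hg
    · by_cases hlk : l = k
      · simp only [hf, if_neg hl0, if_pos hlk]; exact hh
      · simp only [hf, if_neg hl0, if_neg hlk]; exact measurable_const
  have hf0 : f 0 = g := by simp only [hf, if_pos rfl]
  have hfk : f k = h := by simp [hf, hk]
  have hfo : ∀ l, l ≠ 0 → l ≠ k → f l = fun _ => 1 := fun l hl0 hlk => by simp only [hf, if_neg hl0, if_neg hlk]
  -- the third index
  obtain ⟨m, hm0, hmk, huniv⟩ : ∃ m : Fin 3, m ≠ 0 ∧ m ≠ k ∧ ∀ l : Fin 3, l = 0 ∨ l = k ∨ l = m := by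
    fin_cases k
    · exact absurd rfl hk
    · exact ⟨2, by decide, by decide, fun l => by fin_cases l <;> decide⟩
    · exact ⟨1, by decide, by decide, fun l => by fin_cases l <;> decide⟩
  have hprod : ∀ (φ : Fin 3 → ℝ), ∏ l, φ l = φ 0 * φ k * φ m := by
    intro φ
    have huniv' : (Finset.univ : Finset (Fin 3)) = {0, k, m} := by
      ext l; simp only [Finset.mem_univ, Finset.mem_insert, Finset.mem_singleton, true_iff]; exact huniv l
    rw [huniv', Finset.prod_insert (by simp [hk.symm, hm0.symm]), Finset.prod_insert (by simp [hmk.symm]),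
      Finset.prod_singleton, mul_assoc]
  have hpt : ∀ w : V3, g (w 0) * h (w k) = ∏ l, f l (w l) := by
    intro w
    rw [hprod, hf0, hfk, hfo m hm0 hmk, mul_one]
  simp_rw [hpt]
  rw [integral_prod_coord_stdGaussian f hfm, hprod, hf0, hfk, hfo m hm0 hmk, integral_const, smul_eq_mul,
    mul_one, probReal_univ, mul_one]

/-- `∫ e^{−v₀²/2} dγ₃ = (√2)⁻¹`. [folklore] -/
theorem integral_expWeight_stdGaussian :
    ∫ w, Real.exp (-(1 / 2) * (w 0) ^ 2) ∂(stdGaussian V3) = (Real.sqrt 2)⁻¹ := by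
  rw [integral_coord_stdGaussian 0 (by fun_prop : Measurable fun x : ℝ => Real.exp (-(1 / 2) * x ^ 2)),
    integral_exp_neg_half_sq_gaussianReal]

/-- `∫ ‖w‖² e^{−v₀²/2} dγ₃ = (√2)⁻¹³ + 2(√2)⁻¹` (split `‖w‖² = w₀² + w₁² + w₂²`; independent coordinates). [folklore] -/
theorem integral_normSq_mul_expWeight_stdGaussian :
    ∫ w, ‖w‖ ^ 2 * Real.exp (-(1 / 2) * (w 0) ^ 2) ∂(stdGaussian V3) =
      (Real.sqrt 2)⁻¹ ^ 3 + 2 * (Real.sqrt 2)⁻¹ := by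
  -- the three coordinate products
  have h0 : ∫ w, (w 0) ^ 2 * Real.exp (-(1 / 2) * (w 0) ^ 2) ∂(stdGaussian V3) = (Real.sqrt 2)⁻¹ ^ 3 := by
    rw [integral_coord_stdGaussian 0
      (by fun_prop : Measurable fun x : ℝ => x ^ 2 * Real.exp (-(1 / 2) * x ^ 2)),
      integral_sq_mul_exp_neg_half_sq_gaussianReal]
  have hprod : ∀ k : Fin 3, k ≠ 0 →
      ∫ w, (w k) ^ 2 * Real.exp (-(1 / 2) * (w 0) ^ 2) ∂(stdGaussian V3) = (Real.sqrt 2)⁻¹ := by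
    intro k hk
    have h := integral_coord_zero_mul_coord_stdGaussian
      (by fun_prop : Measurable fun x : ℝ => Real.exp (-(1 / 2) * x ^ 2))
      (by fun_prop : Measurable fun x : ℝ => x ^ 2) hk
    simp_rw [mul_comm (Real.exp _)] at h
    rw [h, integral_exp_neg_half_sq_gaussianReal, integral_sq_gaussianReal, mul_one]
  have hsplit : ∀ w : V3, ‖w‖ ^ 2 * Real.exp (-(1 / 2) * (w 0) ^ 2) =
      (w 0) ^ 2 * Real.exp (-(1 / 2) * (w 0) ^ 2) + (w 1) ^ 2 * Real.exp (-(1 / 2) * (w 0) ^ 2) +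
        (w 2) ^ 2 * Real.exp (-(1 / 2) * (w 0) ^ 2) := by
    intro w
    rw [BoltzmannGreenKuboForallN.norm_sq_eq_three]
    ring
  simp_rw [hsplit]
  -- integrability of each term: bounded by `(w k)²`
  have hint : ∀ k : Fin 3, Integrable (fun w : V3 => (w k) ^ 2 * Real.exp (-(1 / 2) * (w 0) ^ 2))
      (stdGaussian V3) := by
    intro k
    refine ((memLp_coord_stdGaussian k 2 (by simp)).integrable_sq).mono' (by fun_prop) (ae_of_all _ fun w => ?_)
    rw [Real.norm_eq_abs, abs_mul, abs_of_nonneg (sq_nonneg _), abs_of_pos (Real.exp_pos _)]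
    refine mul_le_of_le_one_right (sq_nonneg _) ?_
    rw [Real.exp_le_one_iff]
    nlinarith [sq_nonneg (w 0)]
  have h01 : Integrable (fun w : V3 => (w 0) ^ 2 * Real.exp (-(1 / 2) * (w 0) ^ 2) +
      (w 1) ^ 2 * Real.exp (-(1 / 2) * (w 0) ^ 2)) (stdGaussian V3) := (hint 0).add (hint 1)
  rw [integral_add h01 (hint 2), integral_add (hint 0) (hint 1), h0,
    hprod 1 (by decide), hprod 2 (by decide)]
  ring

/-- **`F_A ⊥ 1`**: `∫ A(‖v‖² − 15 + 12√2 e^{−v₀²/2}) M_{1,0,1} dv = 0`. [folklore] -/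
theorem integral_FA_mul_localMaxwellian (A : ℝ) :
    ∫ v : V3, A * (‖v‖ ^ 2 - 15 + 12 * Real.sqrt 2 * Real.exp (-(1 / 2) * (v 0) ^ 2)) *
      localMaxwellian 1 1 (0 : V3) v = 0 := by
  rw [integral_mul_localMaxwellian_one_zero]
  have hint1 : Integrable (fun w : V3 => ‖w‖ ^ 2 - 15) (stdGaussian V3) :=
    integrable_norm_sq_stdGaussian.sub (integrable_const _)
  have hint2 : Integrable (fun w : V3 => 12 * Real.sqrt 2 * Real.exp (-(1 / 2) * (w 0) ^ 2)) (stdGaussian V3) := by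
    refine (integrable_const (12 * Real.sqrt 2)).mono' (by fun_prop) (ae_of_all _ fun w => ?_)
    rw [Real.norm_eq_abs, abs_mul, abs_of_nonneg (by positivity : (0 : ℝ) ≤ 12 * Real.sqrt 2),
      abs_of_pos (Real.exp_pos _)]
    refine mul_le_of_le_one_right (by positivity) ?_
    rw [Real.exp_le_one_iff]
    nlinarith [sq_nonneg (w 0)]
  simp_rw [mul_comm A, integral_mul_const]
  rw [integral_add hint1 hint2, integral_sub integrable_norm_sq_stdGaussian (integrable_const _),
    integral_norm_sq_stdGaussian, integral_const, integral_const_mul, integral_expWeight_stdGaussian]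
  simp only [Fintype.card_fin, Nat.cast_ofNat, smul_eq_mul, probReal_univ, one_mul]
  have hs : Real.sqrt 2 * (Real.sqrt 2)⁻¹ = 1 := mul_inv_cancel₀ (by positivity)
  have hE : (3 : ℝ) - 15 + 12 * Real.sqrt 2 * (Real.sqrt 2)⁻¹ = 0 := by linear_combination 12 * hs
  rw [hE, zero_mul]

/-- **`F_A ⊥ |v|²`**: `∫ A(‖v‖² − 15 + 12√2 e^{−v₀²/2}) ‖v‖² M_{1,0,1} dv = 0` (`15 − 45 + 30`). [folklore] -/
theorem integral_FA_mul_normSq_mul_localMaxwellian (A : ℝ) :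
    ∫ v : V3, A * (‖v‖ ^ 2 - 15 + 12 * Real.sqrt 2 * Real.exp (-(1 / 2) * (v 0) ^ 2)) * ‖v‖ ^ 2 *
      localMaxwellian 1 1 (0 : V3) v = 0 := by
  rw [integral_mul_localMaxwellian_one_zero]
  have hpt : ∀ w : V3, A * (‖w‖ ^ 2 - 15 + 12 * Real.sqrt 2 * Real.exp (-(1 / 2) * (w 0) ^ 2)) * ‖w‖ ^ 2 =
      ((‖w‖ ^ 4 - 15 * ‖w‖ ^ 2) + 12 * Real.sqrt 2 * (‖w‖ ^ 2 * Real.exp (-(1 / 2) * (w 0) ^ 2))) * A := by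
    intro w; ring
  simp_rw [hpt]
  have hint1 : Integrable (fun w : V3 => ‖w‖ ^ 4 - 15 * ‖w‖ ^ 2) (stdGaussian V3) :=
    integrable_norm_pow_four_stdGaussian.sub (integrable_norm_sq_stdGaussian.const_mul _)
  have hint2' : Integrable (fun w : V3 => ‖w‖ ^ 2 * Real.exp (-(1 / 2) * (w 0) ^ 2)) (stdGaussian V3) := by
    refine integrable_norm_sq_stdGaussian.mono' (by fun_prop) (ae_of_all _ fun w => ?_)
    rw [Real.norm_eq_abs, abs_mul, abs_of_nonneg (sq_nonneg _), abs_of_pos (Real.exp_pos _)]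
    refine mul_le_of_le_one_right (sq_nonneg _) ?_
    rw [Real.exp_le_one_iff]
    nlinarith [sq_nonneg (w 0)]
  rw [integral_mul_const, integral_add hint1 (hint2'.const_mul _),
    integral_sub integrable_norm_pow_four_stdGaussian (integrable_norm_sq_stdGaussian.const_mul _),
    integral_const_mul, integral_const_mul, integral_norm_sq_stdGaussian,
    Literature.Probability.Distributions.integral_norm_pow_four_stdGaussian (EuclideanSpace.basisFun (Fin 3) ℝ),
    integral_normSq_mul_expWeight_stdGaussian]
  simp only [Fintype.card_fin, Nat.cast_ofNat]
  have hs : Real.sqrt 2 * (Real.sqrt 2)⁻¹ = 1 := mul_inv_cancel₀ (by positivity)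
  have hs2 : (Real.sqrt 2)⁻¹ ^ 2 = 1 / 2 := by
    rw [inv_pow, Real.sq_sqrt (by norm_num : (0 : ℝ) ≤ 2)]
    norm_num
  have hE : (3 : ℝ) * (3 + 2) - 15 * 3 + 12 * Real.sqrt 2 * ((Real.sqrt 2)⁻¹ ^ 3 + 2 * (Real.sqrt 2)⁻¹) = 0 := by
    linear_combination (12 * (Real.sqrt 2)⁻¹ ^ 2 + 24) * hs + 12 * hs2
  rw [hE, zero_mul]

/-- **`F_A ⊥ v_j`** (even in every coordinate). [folklore] -/
theorem integral_FA_mul_coord_mul_localMaxwellian (A : ℝ) (j : Fin 3) :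
    ∫ v : V3, A * (‖v‖ ^ 2 - 15 + 12 * Real.sqrt 2 * Real.exp (-(1 / 2) * (v 0) ^ 2)) * v j *
      localMaxwellian 1 1 (0 : V3) v = 0 := by
  obtain ⟨R, hR⟩ := exists_velFlip j
  refine integral_eq_zero_of_odd_linearIsometryEquiv R fun v => ?_
  have h0 : (R v 0) ^ 2 = (v 0) ^ 2 := by
    rw [hR v 0]
    split_ifs <;> ring
  rw [localMaxwellian_linearIsometryEquiv, hR v j, if_pos rfl, LinearIsometryEquiv.norm_map, h0]
  ring

/-- **Quadratic growth of `F_A`**: `|F_A(x,v)| ≤ (15 + 12√2)A(1 + ‖v‖²)` for `A ≥ 0`. [folklore] -/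
theorem abs_FA_le {A : ℝ} (hA : 0 ≤ A) (v : V3) :
    |A * (‖v‖ ^ 2 - 15 + 12 * Real.sqrt 2 * Real.exp (-(1 / 2) * (v 0) ^ 2))| ≤
      (15 + 12 * Real.sqrt 2) * A * (1 + ‖v‖ ^ 2) := by
  have he0 : 0 < Real.exp (-(1 / 2) * (v 0) ^ 2) := Real.exp_pos _
  have he1 : Real.exp (-(1 / 2) * (v 0) ^ 2) ≤ 1 := by
    rw [Real.exp_le_one_iff]; nlinarith [sq_nonneg (v 0)]
  have hs : 0 ≤ Real.sqrt 2 := Real.sqrt_nonneg _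
  have hn : 0 ≤ ‖v‖ ^ 2 := sq_nonneg _
  have hin : |‖v‖ ^ 2 - 15 + 12 * Real.sqrt 2 * Real.exp (-(1 / 2) * (v 0) ^ 2)| ≤
      (15 + 12 * Real.sqrt 2) * (1 + ‖v‖ ^ 2) := by
    rw [abs_le]
    constructor <;> nlinarith [mul_nonneg hs he0.le, mul_nonneg hs hn]
  rw [abs_mul, abs_of_nonneg hA]
  calc A * |‖v‖ ^ 2 - 15 + 12 * Real.sqrt 2 * Real.exp (-(1 / 2) * (v 0) ^ 2)|
      ≤ A * ((15 + 12 * Real.sqrt 2) * (1 + ‖v‖ ^ 2)) := mul_le_mul_of_nonneg_left hin hA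
    _ = (15 + 12 * Real.sqrt 2) * A * (1 + ‖v‖ ^ 2) := by ring

/-- **`F_A` dominates the kinetic energy**: `A(‖v‖² − 15) ≤ F_A(x,v)` for `A ≥ 0`. [folklore] -/
theorem affine_le_FA {A : ℝ} (hA : 0 ≤ A) (v : V3) :
    -15 * A + A * ‖v‖ ^ 2 ≤ A * (‖v‖ ^ 2 - 15 + 12 * Real.sqrt 2 * Real.exp (-(1 / 2) * (v 0) ^ 2)) := by
  have he0 : 0 < Real.exp (-(1 / 2) * (v 0) ^ 2) := Real.exp_pos _
  have hs : 0 ≤ Real.sqrt 2 := Real.sqrt_nonneg _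
  nlinarith [mul_nonneg (mul_nonneg hA hs) he0.le]

/-! ## The window moment of `F_A` is `+∞` for `βA ≥ ½` -/

/-- **Window sums of `F_A` dominate the conserved energy sum**: on the good set, for `w > 0` and `A ≥ 0`,
`Σᵢ (−15A + A‖vᵢ(0)‖²) ≤ Σᵢ w⁻¹∫₀ʷ F_A(Φ_r z i) dr`. [folklore] -/
theorem sum_affine_le_windowSum_FA {σ : ℝ} {N : ℕ}
    (Φ : HardSphereFlow (Torus.geometry (Fin 3)) (hsDiameter σ N) (N + 1))
    {z : Config (N + 1) (Fin 3) T3} (hz : z ∈ Φ.good) {A : ℝ} (hA : 0 ≤ A) {w : ℝ} (hw : 0 < w) :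
    ∑ i, (-15 * A + A * ‖(z i).2‖ ^ 2) ≤
      ∑ i, w⁻¹ * ∫ r in (0 : ℝ)..w,
        A * (‖(Φ.flow r z i).2‖ ^ 2 - 15 + 12 * Real.sqrt 2 * Real.exp (-(1 / 2) * ((Φ.flow r z i).2 0) ^ 2)) := by
  rw [← windowSum_affine_normSq_eq Φ hz (-15 * A) A hw]
  refine Finset.sum_le_sum fun i _ => mul_le_mul_of_nonneg_left ?_ (inv_nonneg.2 hw.le)
  refine intervalIntegral.integral_mono_on hw.le ?_ ?_ fun r _ => affine_le_FA hA _
  · exact intervalIntegrable_const.add ((intervalIntegrable_normSq_vel_flow Φ hz i 0 w).const_mul A)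
  · have hH : Measurable fun u : Config (N + 1) (Fin 3) T3 =>
        A * (‖(u i).2‖ ^ 2 - 15 + 12 * Real.sqrt 2 * Real.exp (-(1 / 2) * ((u i).2 0) ^ 2)) := by
      have h1 : Measurable fun u : Config (N + 1) (Fin 3) T3 => (u i).2 := (measurable_pi_apply i).snd
      have h2 : Measurable fun u : Config (N + 1) (Fin 3) T3 => (u i).2 0 :=
        (EuclideanSpace.proj (𝕜 := ℝ) (0 : Fin 3)).continuous.measurable.comp h1
      fun_prop
    refine intervalIntegrable_comp_flow_of_abs_le Φ hz hH
      (C := (15 + 12 * Real.sqrt 2) * A * (1 + 2 * configEnergy z)) (fun r => ?_) 0 w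
    refine (abs_FA_le hA _).trans (mul_le_mul_of_nonneg_left ?_ (by positivity))
    linarith [norm_vel_flow_sq_le Φ hz r i]

/-- **(b.2) The window exponential moment of the admissible `F_A` is `+∞` for `βA ≥ ½`** — at every `σ ≤ 1/2`,
every flow, every window `w > 0`, every `N` (`a₀ > 0`, `θ₀ = 1`, `u₀ = 0`). [folklore] -/
theorem windowMoment_FA_eq_top {a₀ : ℝ} (ha : 0 < a₀) {σ : ℝ} (hσ2 : σ ≤ 1 / 2) (N : ℕ)
    (Φ : HardSphereFlow (Torus.geometry (Fin 3)) (hsDiameter σ N) (N + 1)) {A β : ℝ} (hA : 0 < A) (hβ : 0 < β)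
    (hβA : 1 ≤ 2 * (β * A)) {w : ℝ} (hw : 0 < w) :
    ∫⁻ z, ENNReal.ofReal (Real.exp (β * ∑ i : Fin (N + 1), w⁻¹ * ∫ r in (0 : ℝ)..w,
        A * (‖(Φ.flow r z i).2‖ ^ 2 - 15 + 12 * Real.sqrt 2 * Real.exp (-(1 / 2) * ((Φ.flow r z i).2 0) ^ 2))))
        ∂(localGibbsLaw σ (fun _ => a₀) (fun _ => 0) (fun _ => 1) N Φ) = ∞ := by
  set μ := localGibbsLaw σ (fun _ => a₀) (fun _ => 0) (fun _ => 1) N Φ with hμ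
  have hae : ∀ᵐ z ∂μ, z ∈ Φ.good := mem_ae_iff.2 (localGibbsLaw_const_compl_good σ a₀ 1 0 N Φ)
  -- lower bound by the conserved affine energy observable
  have hmono : ∫⁻ z, ENNReal.ofReal (Real.exp (∑ i : Fin (N + 1),
      (fun v : V3 => β * (-15 * A + A * ‖v‖ ^ 2)) (z i).2)) ∂μ ≤
      ∫⁻ z, ENNReal.ofReal (Real.exp (β * ∑ i : Fin (N + 1), w⁻¹ * ∫ r in (0 : ℝ)..w,
        A * (‖(Φ.flow r z i).2‖ ^ 2 - 15 + 12 * Real.sqrt 2 *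
          Real.exp (-(1 / 2) * ((Φ.flow r z i).2 0) ^ 2)))) ∂μ := by
    refine lintegral_mono_ae ?_
    filter_upwards [hae] with z hz
    refine ENNReal.ofReal_le_ofReal (Real.exp_le_exp.2 ?_)
    rw [← Finset.mul_sum]
    exact mul_le_mul_of_nonneg_left (sum_affine_le_windowSum_FA Φ hz hA.le hw) hβ.le
  refine eq_top_iff.2 (le_trans ?_ hmono)
  rw [hμ, localGibbsLaw_eq, lintegral_exp_sum_vel_localGibbsMeasure ha one_pos (0 : V3) hσ2 N
    (by fun_prop : Measurable fun v : V3 => β * (-15 * A + A * ‖v‖ ^ 2)), gaussMeasure_zero_one]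
  have hpt : ∀ v : V3, ENNReal.ofReal (Real.exp (β * (-15 * A + A * ‖v‖ ^ 2))) =
      ENNReal.ofReal (Real.exp (-(15 * (β * A)))) * ENNReal.ofReal (Real.exp ((β * A) * ‖v‖ ^ 2)) := by
    intro v
    rw [← ENNReal.ofReal_mul (Real.exp_pos _).le, ← Real.exp_add]
    congr 2; ring
  simp_rw [hpt]
  rw [lintegral_const_mul _ (by fun_prop), lintegral_exp_mul_normSq_stdGaussian_eq_top hβA,
    ENNReal.mul_top (ENNReal.ofReal_pos.2 (Real.exp_pos _)).ne', ENNReal.top_pow (Nat.succ_ne_zero N)]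

/-- **The β-ceiling**: if the window moment of `F_A` at a tilt `β > 0` is finite for SOME window, flow and `N`,
then `β < 1/(2A)`. [folklore] -/
theorem two_mul_beta_mul_lt_one_of_windowMoment_ne_top {a₀ : ℝ} (ha : 0 < a₀) {σ : ℝ} (hσ2 : σ ≤ 1 / 2)
    {N : ℕ} (Φ : HardSphereFlow (Torus.geometry (Fin 3)) (hsDiameter σ N) (N + 1)) {A β : ℝ} (hA : 0 < A)
    (hβ : 0 < β) {w : ℝ} (hw : 0 < w)
    (hfin : ∫⁻ z, ENNReal.ofReal (Real.exp (β * ∑ i : Fin (N + 1), w⁻¹ * ∫ r in (0 : ℝ)..w,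
        A * (‖(Φ.flow r z i).2‖ ^ 2 - 15 + 12 * Real.sqrt 2 * Real.exp (-(1 / 2) * ((Φ.flow r z i).2 0) ^ 2))))
        ∂(localGibbsLaw σ (fun _ => a₀) (fun _ => 0) (fun _ => 1) N Φ) ≠ ∞) :
    2 * (β * A) < 1 := by
  by_contra h
  exact hfin (windowMoment_FA_eq_top ha hσ2 N Φ hA hβ (not_lt.1 h) hw)

end Summit.AtomisticToContinuum.HydrodynamicLimit.Theorems.EquilibriumFastWindowLDNegative

end
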